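import Summits.QuantumFields.YangMills.Theorems.PoincareLipschitzLogCutoffCapacity
import Summits.QuantumFields.YangMills.Theorems.PoincareLipschitzLeungXinGraphStabilitySlack
import HarnessLib

/-!
# Crux `HistoryTailL` (stmt-QuantumFields-19936), K2 organ of record `hImproveCoreFlat` (LEAD ★w1-19936 g9 g9-8, FROZEN v1 bac8eda3):
# ★★★ THE LOG-CUTOFF STABILITY CAP FOR FLAT ALMOST-MINIMISERS ON `ℤ³` — for a unit `ℝ⁴`-valued lattice map whose Leung–Xin variations raise the
# bond correlation by at most a SLACK `σ` (the flat organ's `δ(ρ+1)`-row), EVERY window `[M∕C₁(c), M)` contains a scale `k` with box energy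
# `E_k ≤ c·k`, for every `c ≥ 20`, provided the normalised slack `3200σ ≤ r` — the «bounded ⇒ capped» half of Schoen–Uhlenbeck for
# ALMOST-minimisers (finite dilation `t = 1∕20` in ★w2 g12's ✓p712185 slack second variation)

Cell `ym3-torus` (YM ladder rung R3 = continuum SU(2) Yang–Mills on the three-torus — a RUNG, NOT the Clay problem: not d = 4, not infinite
volume, not a mass gap), WIDTH seat `ym-ust-19936-w3` gen 14; `--supports stmt-QuantumFields-19936 --as helper`; THEOREMS ONLY, definition-free.
Imports ✓p711527 `…LogCutoffCapacity` (capacity `6r(H+2) + 96r`, Abel lower bound, window letter; brings ✓p710624 letters) and ✓p712185 ★w2 g12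
`…LeungXinGraphStabilitySlack` (`sum_hessianForm_le_of_forall_dot_le_add`: the ±t comparison with an additive slack at finite dilation).

WHY.  ERRATUM-DRIVEN (★w3 g14 10:26Z, withdrawing the 08:36Z located point «Flat's slack row is second-variation-dead»): ★w2's exact bracket
algebra shows that under almost-minimality `Σ corr(U_t) ≤ Σ corr(u) + σ` the finite-dilation remainder of the Leung–Xin second variation is
`8σ∕t² + 3t²·Σ_b[(1−c_b)(A_b+B_b) + |v_b − w_b|²]`, and summed over the four conformal fields the bracket is `3(2−c)(η_x²+η_y²) − 2η_xη_y(2+c²)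
≤ 9(η_x−η_y)² + 5η_xη_y e_b` (`e ≤ 4`) — ENERGY and GRADIENT terms only, no volume term.  Hence, at `t = 1∕20`,
`(77∕80)·Σηηe ≤ (1227∕400)·Σ(dη)² + 3200σ`: with the sup-norm LOG PROFILE (✓`exists_logProfile`) the main terms are `≍ r·log C₁` and the slack
term is `≍ δR ≍ δC₁r` — BOTH LINEAR IN THE SCALE — so a supplier-chosen `δ ≲ 1∕C₁(c)` (legal: the flat organ's `∃δ` follows `ε₁`) makes the slack
harmless.  The rest is ✓C's argument: Abel (✓`sum_box_energy_le_sum_profile`), capacity (✓`sum_sq_sub_profile_le`), `H ≥ log` (✓`le_harmonic_of_window`),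
and the closing arithmetic `(77c∕80 − 18.405)·H < 333` for `c ≥ 20` (§1 `cap_arith_flat`).  Consumer: `…FlatOrganOfFlatCapped`
(`hImproveCoreFlat v1 ⟸ hImproveCoreFlat∣_{Λ₀ := 20}` — the organ of record is parameter-free inside the FLAT world, no K-5 detour).

WHAT (ns `…Theorems.PoincareLipschitzLogCutoffStabilityCapFlat`).
* §1 `rem_le` (the four-field remainder `≤ 9(dη)² + 5ηηe`), `cap_arith_flat`.
* §2 ★★★`exists_scale_energy_le_flat (hc : 20 ≤ c)` (decl-local `maxHeartbeats 400000`, RULING №24 (d)).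
HONEST SCOPE.  A theorem about lattice maps under an almost-minimality HYPOTHESIS; nothing of `hImproveCoreFlat` (the capped ⇒ small half = the gap ∕
compactness half, NOT in print on `ℤ³`), `hImproveCore`, `hImprove`, K1-exp, `MeanDeviationL`, `BlockLipschitzL`, `HistoryTailL` or any summit
statement is proved.  YM₃ on T³ is rung R3, NOT the Clay problem.

References: R. Schoen, K. Uhlenbeck, Invent. Math. **78** (1984) 89–100 [SchoenUhlenbeck1984] §2; Y. L. Xin, Duke Math. J. **47** (1980) 609–613 [Xin1980];
S. Luckhaus, Indiana Univ. Math. J. **37** (1988) 349–367 (almost-minimisers).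
-/

set_option autoImplicit false

open scoped BigOperators
open Finset Matrix

namespace Summit.QuantumFields.YangMills.Theorems.PoincareLipschitzLogCutoffStabilityCapFlat

open Literature.MathematicalPhysics.QuantumFieldTheory.Balaban1983to89.B4Eq19LatticeOperators
  (Zd unitVec box mem_box box_mono card_box add_unitVec_mem_box sub_unitVec_mem_box)
open Summit.QuantumFields.YangMills.Theorems.PoincareLipschitzLeungXinSphereIdentity
  (sum_bondHessian_eq sum_secondVariation_eq sum_tang_dot_tang sum_tang_normSq tang_normSq single_dot)
open Summit.QuantumFields.YangMills.Theorems.PoincareLipschitzLeungXinGraphStabilitySlack (sum_hessianForm_le_of_forall_dot_le_add)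
open Summit.QuantumFields.YangMills.Theorems.PoincareLipschitzLeungXinBoxCaccioppoli (dot_le_one)
open Summit.QuantumFields.YangMills.Theorems.PoincareLipschitzLogCutoffLetters (exists_supIndex supIndex_step exists_logProfile)
open Summit.QuantumFields.YangMills.Theorems.PoincareLipschitzLogCutoffCapacity
  (sum_sq_sub_profile_le sum_box_energy_le_sum_profile le_harmonic_of_window)

/-! ## §1 The four-field remainder and the closing arithmetic -/

/-- **THE FOUR-FIELD REMAINDER** of ★w2's slack second variation, summed over the conformal fields: for unit `p, q ∈ ℝ⁴` and weights `α, β ≥ 0`,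
`Σ_a [(1 − p·q)(α²|v_a(p)|² + β²|v_a(q)|²) + (α²|v_a(p)|² + β²|v_a(q)|² − 2αβ v_a(p)·v_a(q))] = 3(2 − c)(α²+β²) − 2αβ(2 + c²) ≤ 9(α−β)² + 5αβ·e`,
`c = p·q`, `e = |p − q|² = 2 − 2c ≤ 4`. [folklore] [cite: Xin1980, p.609–613] -/
theorem rem_le (p q : Fin 4 → ℝ) (hp : dotProduct p p = 1) (hq : dotProduct q q = 1) {α β : ℝ} (hα : 0 ≤ α) (hβ : 0 ≤ β) :
    ∑ a : Fin 4, ((1 - dotProduct p q) *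
        (dotProduct (α • (Pi.single a 1 - dotProduct (Pi.single a 1) p • p)) (α • (Pi.single a 1 - dotProduct (Pi.single a 1) p • p)) +
          dotProduct (β • (Pi.single a 1 - dotProduct (Pi.single a 1) q • q)) (β • (Pi.single a 1 - dotProduct (Pi.single a 1) q • q))) +
      (dotProduct (α • (Pi.single a 1 - dotProduct (Pi.single a 1) p • p)) (α • (Pi.single a 1 - dotProduct (Pi.single a 1) p • p)) +
        dotProduct (β • (Pi.single a 1 - dotProduct (Pi.single a 1) q • q)) (β • (Pi.single a 1 - dotProduct (Pi.single a 1) q • q)) -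
        2 * dotProduct (α • (Pi.single a 1 - dotProduct (Pi.single a 1) p • p)) (β • (Pi.single a 1 - dotProduct (Pi.single a 1) q • q)))) ≤
      9 * (α - β) ^ 2 + 5 * (α * β) * dotProduct (p - q) (p - q) := by
  have hsum : ∑ a : Fin 4, ((1 - dotProduct p q) *
        (dotProduct (α • (Pi.single a 1 - dotProduct (Pi.single a 1) p • p)) (α • (Pi.single a 1 - dotProduct (Pi.single a 1) p • p)) +
          dotProduct (β • (Pi.single a 1 - dotProduct (Pi.single a 1) q • q)) (β • (Pi.single a 1 - dotProduct (Pi.single a 1) q • q))) +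
      (dotProduct (α • (Pi.single a 1 - dotProduct (Pi.single a 1) p • p)) (α • (Pi.single a 1 - dotProduct (Pi.single a 1) p • p)) +
        dotProduct (β • (Pi.single a 1 - dotProduct (Pi.single a 1) q • q)) (β • (Pi.single a 1 - dotProduct (Pi.single a 1) q • q)) -
        2 * dotProduct (α • (Pi.single a 1 - dotProduct (Pi.single a 1) p • p)) (β • (Pi.single a 1 - dotProduct (Pi.single a 1) q • q)))) =
      3 * (2 - dotProduct p q) * (α ^ 2 + β ^ 2) - 2 * (α * β) * (2 + dotProduct p q ^ 2) := by
    have h1 := sum_tang_normSq p hp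
    have h2 := sum_tang_normSq q hq
    have h3 := sum_tang_dot_tang p q hp hq
    have key : ∀ a : Fin 4, ((1 - dotProduct p q) *
        (dotProduct (α • (Pi.single a 1 - dotProduct (Pi.single a 1) p • p)) (α • (Pi.single a 1 - dotProduct (Pi.single a 1) p • p)) +
          dotProduct (β • (Pi.single a 1 - dotProduct (Pi.single a 1) q • q)) (β • (Pi.single a 1 - dotProduct (Pi.single a 1) q • q))) +
      (dotProduct (α • (Pi.single a 1 - dotProduct (Pi.single a 1) p • p)) (α • (Pi.single a 1 - dotProduct (Pi.single a 1) p • p)) +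
        dotProduct (β • (Pi.single a 1 - dotProduct (Pi.single a 1) q • q)) (β • (Pi.single a 1 - dotProduct (Pi.single a 1) q • q)) -
        2 * dotProduct (α • (Pi.single a 1 - dotProduct (Pi.single a 1) p • p)) (β • (Pi.single a 1 - dotProduct (Pi.single a 1) q • q)))) =
        (2 - dotProduct p q) * α ^ 2 * dotProduct (Pi.single a 1 - dotProduct (Pi.single a 1) p • p) (Pi.single a 1 - dotProduct (Pi.single a 1) p • p) +
        (2 - dotProduct p q) * β ^ 2 * dotProduct (Pi.single a 1 - dotProduct (Pi.single a 1) q • q) (Pi.single a 1 - dotProduct (Pi.single a 1) q • q) -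
        2 * (α * β) * dotProduct (Pi.single a 1 - dotProduct (Pi.single a 1) p • p) (Pi.single a 1 - dotProduct (Pi.single a 1) q • q) := by
      intro a
      simp only [smul_dotProduct, dotProduct_smul, smul_eq_mul]
      ring
    rw [Finset.sum_congr rfl fun a _ => key a, Finset.sum_sub_distrib, Finset.sum_add_distrib, ← Finset.mul_sum, ← Finset.mul_sum,
      ← Finset.mul_sum, h1, h2, h3]
    ring
  rw [hsum]
  -- `e = 2 − 2c`, `−1 ≤ c ≤ 1`
  have he : dotProduct (p - q) (p - q) = 2 - 2 * dotProduct p q := by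
    rw [sub_dotProduct, dotProduct_sub, dotProduct_sub, hp, hq, dotProduct_comm q p]; ring
  have hc1 : dotProduct p q ≤ 1 := dot_le_one hp hq
  have hcm : -1 ≤ dotProduct p q := by
    have h0 : 0 ≤ dotProduct (p + q) (p + q) := by
      simp only [dotProduct, Pi.add_apply]; exact Finset.sum_nonneg fun i _ => mul_self_nonneg _
    rw [add_dotProduct, dotProduct_add, dotProduct_add, hp, hq, dotProduct_comm q p] at h0
    linarith
  rw [he]
  have hαβ : 0 ≤ α * β := mul_nonneg hα hβ
  nlinarith [sq_nonneg (α - β), mul_nonneg hαβ (sub_nonneg.2 hc1), mul_nonneg hαβ (by linarith : (0:ℝ) ≤ 1 + dotProduct p q),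
    sq_nonneg (dotProduct p q), mul_nonneg hαβ (sq_nonneg (dotProduct p q))]

/-- The closing arithmetic of the flat cap: `X > c·r·H`, `(77∕80)X ≤ (1227∕400)G + W`, `G ≤ 6rH + 108r`, `W ≤ r`, `c ≥ 20` force
`H < 333∕(77c∕80 − 18.405)`. [folklore] -/
theorem cap_arith_flat {c r H X G W : ℝ} (hc : 20 ≤ c) (hr : 0 < r)
    (hX : c * r * H < X) (hmain : 77 / 80 * X ≤ 1227 / 400 * G + W) (hG : G ≤ 6 * r * H + 108 * r) (hW : W ≤ r) :
    H < 333 / (77 / 80 * c - 18405 / 1000) := by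
  have hden : 0 < 77 / 80 * c - 18405 / 1000 := by linarith
  rw [lt_div_iff₀ hden]
  have h1 : 77 / 80 * (c * r * H) < 77 / 80 * X := by linarith
  have h3 : 77 / 80 * (c * r * H) < 1227 / 400 * (6 * r * H + 108 * r) + r := by nlinarith
  -- divide by `r`
  have h4 : (77 / 80 * c - 18405 / 1000) * H * r < 333 * r := by nlinarith
  by_contra hcon
  push Not at hcon
  have : 333 * r ≤ (77 / 80 * c - 18405 / 1000) * H * r := by
    have := mul_le_mul_of_nonneg_right hcon hr.le
    linarith
  linarith

/-! ## §2 The flat stability cap: one good scale per window, from almost-minimality -/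

set_option maxHeartbeats 400000 in
/-- ★★★ **THE LOG-CUTOFF STABILITY CAP FOR FLAT ALMOST-MINIMISERS ON `ℤ³`.**  Let `u : ℤ³ → S³ ⊂ ℝ⁴` and suppose that on a finite bond set `T`,
for every cutoff `0 ≤ η ≤ 1` supported in `Q_{2M}(z)`, every coordinate field `a` and every `t`, the bond correlation of the Leung–Xin varied map exceeds
that of `u` by at most `σ` (the flat organ's almost-minimality with slack, in correlation form), with the normalised slack `3200σ ≤ r`.  Then for
every `c ≥ 20` there is `C₁(c) = 2·exp(333∕(77c∕80 − 18.405))` such that `C₁r ≤ M` forces a scale `k ∈ [r, M)` with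
`E_k = Σ_{b ∈ T, both ends in Q_k(z)} |u_x − u_y|² ≤ c·k` — no energy hypothesis.  (★w2's finite-dilation slack second variation at `t = 1∕20`, summed
over the four conformal fields, `rem_le`; the log profile of ✓`exists_logProfile`; Abel; capacity; `H ≥ log`.)
[cite: SchoenUhlenbeck1984, §2; Xin1980, p.609–613] -/
theorem exists_scale_energy_le_flat {c : ℝ} (hc : 20 ≤ c) : ∃ C₁ : ℝ, 1 ≤ C₁ ∧
    ∀ (T : Finset (Zd 3 × Fin 3)) (u : Zd 3 → Fin 4 → ℝ) (z : Zd 3) (r M : ℕ) (σ : ℝ),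
      (∀ x, dotProduct (u x) (u x) = 1) → 1 ≤ r → C₁ * r ≤ M → 3200 * σ ≤ r →
      (∀ η : Zd 3 → ℝ, (∀ y ∉ box z (2 * (M : ℤ)), η y = 0) → (∀ y, 0 ≤ η y) → (∀ y, η y ≤ 1) → ∀ (a : Fin 4) (t : ℝ),
        ∑ b ∈ T, dotProduct
          ((Real.sqrt (1 + t ^ 2 * dotProduct (η b.1 • (Pi.single a 1 - dotProduct (Pi.single a 1) (u b.1) • u b.1))
              (η b.1 • (Pi.single a 1 - dotProduct (Pi.single a 1) (u b.1) • u b.1))))⁻¹ •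
            (u b.1 + t • (η b.1 • (Pi.single a 1 - dotProduct (Pi.single a 1) (u b.1) • u b.1))))
          ((Real.sqrt (1 + t ^ 2 * dotProduct (η (b.1 + unitVec b.2) •
                (Pi.single a 1 - dotProduct (Pi.single a 1) (u (b.1 + unitVec b.2)) • u (b.1 + unitVec b.2)))
              (η (b.1 + unitVec b.2) • (Pi.single a 1 - dotProduct (Pi.single a 1) (u (b.1 + unitVec b.2)) • u (b.1 + unitVec b.2)))))⁻¹ •
            (u (b.1 + unitVec b.2) + t • (η (b.1 + unitVec b.2) •
              (Pi.single a 1 - dotProduct (Pi.single a 1) (u (b.1 + unitVec b.2)) • u (b.1 + unitVec b.2))))) ≤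
        (∑ b ∈ T, dotProduct (u b.1) (u (b.1 + unitVec b.2))) + σ) →
      ∃ k : ℕ, r ≤ k ∧ k < M ∧
        ∑ b ∈ T.filter (fun b => b.1 ∈ box z (k : ℤ) ∧ b.1 + unitVec b.2 ∈ box z (k : ℤ)),
          dotProduct (u b.1 - u (b.1 + unitVec b.2)) (u b.1 - u (b.1 + unitVec b.2)) ≤ c * k := by
  have hden : 0 < 77 / 80 * c - 18405 / 1000 := by linarith
  set H₀ : ℝ := 333 / (77 / 80 * c - 18405 / 1000) with hH₀
  have hH₀0 : 0 ≤ H₀ := div_nonneg (by norm_num) hden.le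
  have hexp1 : 1 ≤ Real.exp H₀ := Real.one_le_exp hH₀0
  refine ⟨2 * Real.exp H₀, by linarith, ?_⟩
  intro T u z r M σ hu hr hM hσ hmin
  classical
  have hr0 : (0 : ℝ) < r := by exact_mod_cast hr
  have hrM : r < M := by
    have : (r : ℝ) < M := by nlinarith
    exact_mod_cast this
  have h2M : ((2 * M : ℕ) : ℤ) = 2 * (M : ℤ) := by push_cast; ring
  -- the shell index and the profile
  obtain ⟨N, hN⟩ := exists_supIndex z
  obtain ⟨f, hf0, hf1, hanti, hzero, hone, hsq, hlogInc, htapInc⟩ := exists_logProfile r M hr hrM.le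
  set η : Zd 3 → ℝ := fun y => f (N y) with hη
  have hη0 : ∀ y, 0 ≤ η y := fun y => hf0 _
  have hη1 : ∀ y, η y ≤ 1 := fun y => hf1 _
  have hNout : ∀ y, y ∉ box z (2 * (M : ℤ)) → 2 * M + 1 ≤ N y := by
    intro y hy
    rw [← h2M, hN] at hy
    omega
  have hηout : ∀ y ∉ box z (2 * (M : ℤ)), η y = 0 := fun y hy => hzero _ (by have := hNout y hy; omega)
  -- per field: ★w2's slack second variation at `t = 1/20`
  have ht0 : (1 / 20 : ℝ) ≠ 0 := by norm_num
  have ht1 : (1 / 20 : ℝ) ^ 2 ≤ 1 := by norm_num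
  have htang1 : ∀ (x : Zd 3) (a : Fin 4), dotProduct (η x • (Pi.single a 1 - dotProduct (Pi.single a 1) (u x) • u x))
      (η x • (Pi.single a 1 - dotProduct (Pi.single a 1) (u x) • u x)) ≤ 1 := by
    intro x a
    rw [smul_dotProduct, dotProduct_smul, smul_eq_mul, smul_eq_mul, tang_normSq a (u x) (hu x)]
    have h1 : η x * η x ≤ 1 := by nlinarith [hη0 x, hη1 x]
    have h2 : 0 ≤ u x a * u x a := mul_self_nonneg _
    have h3 : u x a * u x a ≤ 1 := by
      have : u x a * u x a ≤ dotProduct (u x) (u x) := by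
        simp only [dotProduct]
        exact Finset.single_le_sum (f := fun i => u x i * u x i) (fun i _ => mul_self_nonneg _) (Finset.mem_univ a)
      rw [hu x] at this; exact this
    nlinarith [hη0 x]
  have hfield : ∀ a : Fin 4,
      ∑ b ∈ T, (2 * dotProduct (η b.1 • (Pi.single a 1 - dotProduct (Pi.single a 1) (u b.1) • u b.1))
            (η (b.1 + unitVec b.2) • (Pi.single a 1 - dotProduct (Pi.single a 1) (u (b.1 + unitVec b.2)) • u (b.1 + unitVec b.2))) -
          dotProduct (u b.1) (u (b.1 + unitVec b.2)) *
            (dotProduct (η b.1 • (Pi.single a 1 - dotProduct (Pi.single a 1) (u b.1) • u b.1))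
                (η b.1 • (Pi.single a 1 - dotProduct (Pi.single a 1) (u b.1) • u b.1)) +
              dotProduct (η (b.1 + unitVec b.2) • (Pi.single a 1 - dotProduct (Pi.single a 1) (u (b.1 + unitVec b.2)) • u (b.1 + unitVec b.2)))
                (η (b.1 + unitVec b.2) • (Pi.single a 1 - dotProduct (Pi.single a 1) (u (b.1 + unitVec b.2)) • u (b.1 + unitVec b.2))))) ≤
        2 * σ / (1 / 20 : ℝ) ^ 2 + 3 * (1 / 20 : ℝ) ^ 2 * ∑ b ∈ T,
          ((1 - dotProduct (u b.1) (u (b.1 + unitVec b.2))) *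
              (dotProduct (η b.1 • (Pi.single a 1 - dotProduct (Pi.single a 1) (u b.1) • u b.1))
                  (η b.1 • (Pi.single a 1 - dotProduct (Pi.single a 1) (u b.1) • u b.1)) +
                dotProduct (η (b.1 + unitVec b.2) • (Pi.single a 1 - dotProduct (Pi.single a 1) (u (b.1 + unitVec b.2)) • u (b.1 + unitVec b.2)))
                  (η (b.1 + unitVec b.2) • (Pi.single a 1 - dotProduct (Pi.single a 1) (u (b.1 + unitVec b.2)) • u (b.1 + unitVec b.2)))) +
            (dotProduct (η b.1 • (Pi.single a 1 - dotProduct (Pi.single a 1) (u b.1) • u b.1))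
                (η b.1 • (Pi.single a 1 - dotProduct (Pi.single a 1) (u b.1) • u b.1)) +
              dotProduct (η (b.1 + unitVec b.2) • (Pi.single a 1 - dotProduct (Pi.single a 1) (u (b.1 + unitVec b.2)) • u (b.1 + unitVec b.2)))
                (η (b.1 + unitVec b.2) • (Pi.single a 1 - dotProduct (Pi.single a 1) (u (b.1 + unitVec b.2)) • u (b.1 + unitVec b.2))) -
              2 * dotProduct (η b.1 • (Pi.single a 1 - dotProduct (Pi.single a 1) (u b.1) • u b.1))
                (η (b.1 + unitVec b.2) • (Pi.single a 1 - dotProduct (Pi.single a 1) (u (b.1 + unitVec b.2)) • u (b.1 + unitVec b.2))))) :=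
    fun a => sum_hessianForm_le_of_forall_dot_le_add T (fun b => u b.1) (fun b => u (b.1 + unitVec b.2))
      (fun b => η b.1 • (Pi.single a 1 - dotProduct (Pi.single a 1) (u b.1) • u b.1))
      (fun b => η (b.1 + unitVec b.2) • (Pi.single a 1 - dotProduct (Pi.single a 1) (u (b.1 + unitVec b.2)) • u (b.1 + unitVec b.2)))
      (fun t => hmin η hηout hη0 hη1 a t) (fun b _ => dot_le_one (hu _) (hu _)) (fun b _ => htang1 _ _) (fun b _ => htang1 _ _) ht0 ht1
  -- per-bond identities
  have hL : ∀ b : Zd 3 × Fin 3, ∑ a : Fin 4,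
      (2 * dotProduct (η b.1 • (Pi.single a 1 - dotProduct (Pi.single a 1) (u b.1) • u b.1))
          (η (b.1 + unitVec b.2) • (Pi.single a 1 - dotProduct (Pi.single a 1) (u (b.1 + unitVec b.2)) • u (b.1 + unitVec b.2))) -
        dotProduct (u b.1) (u (b.1 + unitVec b.2)) *
          (dotProduct (η b.1 • (Pi.single a 1 - dotProduct (Pi.single a 1) (u b.1) • u b.1))
              (η b.1 • (Pi.single a 1 - dotProduct (Pi.single a 1) (u b.1) • u b.1)) +
            dotProduct (η (b.1 + unitVec b.2) • (Pi.single a 1 - dotProduct (Pi.single a 1) (u (b.1 + unitVec b.2)) • u (b.1 + unitVec b.2)))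
              (η (b.1 + unitVec b.2) • (Pi.single a 1 - dotProduct (Pi.single a 1) (u (b.1 + unitVec b.2)) • u (b.1 + unitVec b.2))))) =
      η b.1 * η (b.1 + unitVec b.2) * dotProduct (u b.1 - u (b.1 + unitVec b.2)) (u b.1 - u (b.1 + unitVec b.2)) *
          (1 + dotProduct (u b.1 - u (b.1 + unitVec b.2)) (u b.1 - u (b.1 + unitVec b.2)) / 2) -
        3 * dotProduct (u b.1) (u (b.1 + unitVec b.2)) * (η b.1 - η (b.1 + unitVec b.2)) ^ 2 := by
    intro b
    have h1 := sum_bondHessian_eq (u b.1) (u (b.1 + unitVec b.2)) (hu _) (hu _) (η b.1) (η (b.1 + unitVec b.2))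
    have h2 := sum_secondVariation_eq (u b.1) (u (b.1 + unitVec b.2)) (hu _) (hu _) (η b.1) (η (b.1 + unitVec b.2))
    have h3 : ∑ a : Fin 4,
        (2 * dotProduct (η b.1 • (Pi.single a 1 - dotProduct (Pi.single a 1) (u b.1) • u b.1))
            (η (b.1 + unitVec b.2) • (Pi.single a 1 - dotProduct (Pi.single a 1) (u (b.1 + unitVec b.2)) • u (b.1 + unitVec b.2))) -
          dotProduct (u b.1) (u (b.1 + unitVec b.2)) *
            (dotProduct (η b.1 • (Pi.single a 1 - dotProduct (Pi.single a 1) (u b.1) • u b.1))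
                (η b.1 • (Pi.single a 1 - dotProduct (Pi.single a 1) (u b.1) • u b.1)) +
              dotProduct (η (b.1 + unitVec b.2) • (Pi.single a 1 - dotProduct (Pi.single a 1) (u (b.1 + unitVec b.2)) • u (b.1 + unitVec b.2)))
                (η (b.1 + unitVec b.2) • (Pi.single a 1 - dotProduct (Pi.single a 1) (u (b.1 + unitVec b.2)) • u (b.1 + unitVec b.2))))) =
        ∑ a : Fin 4, (2 * η b.1 * η (b.1 + unitVec b.2) *
            dotProduct (Pi.single a 1 - dotProduct (Pi.single a 1) (u b.1) • u b.1)
              (Pi.single a 1 - dotProduct (Pi.single a 1) (u (b.1 + unitVec b.2)) • u (b.1 + unitVec b.2)) -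
          dotProduct (u b.1) (u (b.1 + unitVec b.2)) *
            (η b.1 ^ 2 * dotProduct (Pi.single a 1 - dotProduct (Pi.single a 1) (u b.1) • u b.1) (Pi.single a 1 - dotProduct (Pi.single a 1) (u b.1) • u b.1) +
              η (b.1 + unitVec b.2) ^ 2 * dotProduct (Pi.single a 1 - dotProduct (Pi.single a 1) (u (b.1 + unitVec b.2)) • u (b.1 + unitVec b.2))
                (Pi.single a 1 - dotProduct (Pi.single a 1) (u (b.1 + unitVec b.2)) • u (b.1 + unitVec b.2)))) := by
      refine Finset.sum_congr rfl fun a _ => ?_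
      simp only [smul_dotProduct, dotProduct_smul, smul_eq_mul]
      ring
    rw [h3, h1]
    rw [h1] at h2
    linarith
  have hR : ∀ b : Zd 3 × Fin 3, ∑ a : Fin 4,
      ((1 - dotProduct (u b.1) (u (b.1 + unitVec b.2))) *
          (dotProduct (η b.1 • (Pi.single a 1 - dotProduct (Pi.single a 1) (u b.1) • u b.1))
              (η b.1 • (Pi.single a 1 - dotProduct (Pi.single a 1) (u b.1) • u b.1)) +
            dotProduct (η (b.1 + unitVec b.2) • (Pi.single a 1 - dotProduct (Pi.single a 1) (u (b.1 + unitVec b.2)) • u (b.1 + unitVec b.2)))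
              (η (b.1 + unitVec b.2) • (Pi.single a 1 - dotProduct (Pi.single a 1) (u (b.1 + unitVec b.2)) • u (b.1 + unitVec b.2)))) +
        (dotProduct (η b.1 • (Pi.single a 1 - dotProduct (Pi.single a 1) (u b.1) • u b.1))
            (η b.1 • (Pi.single a 1 - dotProduct (Pi.single a 1) (u b.1) • u b.1)) +
          dotProduct (η (b.1 + unitVec b.2) • (Pi.single a 1 - dotProduct (Pi.single a 1) (u (b.1 + unitVec b.2)) • u (b.1 + unitVec b.2)))
            (η (b.1 + unitVec b.2) • (Pi.single a 1 - dotProduct (Pi.single a 1) (u (b.1 + unitVec b.2)) • u (b.1 + unitVec b.2))) -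
          2 * dotProduct (η b.1 • (Pi.single a 1 - dotProduct (Pi.single a 1) (u b.1) • u b.1))
            (η (b.1 + unitVec b.2) • (Pi.single a 1 - dotProduct (Pi.single a 1) (u (b.1 + unitVec b.2)) • u (b.1 + unitVec b.2))))) ≤
      9 * (η b.1 - η (b.1 + unitVec b.2)) ^ 2 +
        5 * (η b.1 * η (b.1 + unitVec b.2)) * dotProduct (u b.1 - u (b.1 + unitVec b.2)) (u b.1 - u (b.1 + unitVec b.2)) :=
    fun b => rem_le (u b.1) (u (b.1 + unitVec b.2)) (hu _) (hu _) (hη0 _) (hη0 _)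
  -- assemble: `Σ [ηηe(1+e/2) − 3c(dη)²] ≤ 3200σ + (3/400)·Σ(9(dη)² + 5ηηe)`
  have he0 : ∀ b : Zd 3 × Fin 3, 0 ≤ dotProduct (u b.1 - u (b.1 + unitVec b.2)) (u b.1 - u (b.1 + unitVec b.2)) := fun b => by
    simp only [dotProduct, Pi.sub_apply]
    exact Finset.sum_nonneg fun i _ => mul_self_nonneg _
  have hmainb : ∑ b ∈ T, (η b.1 * η (b.1 + unitVec b.2) * dotProduct (u b.1 - u (b.1 + unitVec b.2)) (u b.1 - u (b.1 + unitVec b.2)) *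
          (1 + dotProduct (u b.1 - u (b.1 + unitVec b.2)) (u b.1 - u (b.1 + unitVec b.2)) / 2) -
        3 * dotProduct (u b.1) (u (b.1 + unitVec b.2)) * (η b.1 - η (b.1 + unitVec b.2)) ^ 2) ≤
      3200 * σ + 3 / 400 * ∑ b ∈ T, (9 * (η b.1 - η (b.1 + unitVec b.2)) ^ 2 +
        5 * (η b.1 * η (b.1 + unitVec b.2)) * dotProduct (u b.1 - u (b.1 + unitVec b.2)) (u b.1 - u (b.1 + unitVec b.2))) := by
    have h4 := Finset.sum_le_sum fun a (_ : a ∈ (Finset.univ : Finset (Fin 4))) => hfield a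
    rw [Finset.sum_add_distrib, Finset.sum_const, Finset.card_univ, Fintype.card_fin, ← Finset.mul_sum, nsmul_eq_mul] at h4
    rw [Finset.sum_comm] at h4
    simp only [hL] at h4
    have hR' : ∑ a : Fin 4, ∑ b ∈ T,
        ((1 - dotProduct (u b.1) (u (b.1 + unitVec b.2))) *
            (dotProduct (η b.1 • (Pi.single a 1 - dotProduct (Pi.single a 1) (u b.1) • u b.1))
                (η b.1 • (Pi.single a 1 - dotProduct (Pi.single a 1) (u b.1) • u b.1)) +
              dotProduct (η (b.1 + unitVec b.2) • (Pi.single a 1 - dotProduct (Pi.single a 1) (u (b.1 + unitVec b.2)) • u (b.1 + unitVec b.2)))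
                (η (b.1 + unitVec b.2) • (Pi.single a 1 - dotProduct (Pi.single a 1) (u (b.1 + unitVec b.2)) • u (b.1 + unitVec b.2)))) +
          (dotProduct (η b.1 • (Pi.single a 1 - dotProduct (Pi.single a 1) (u b.1) • u b.1))
              (η b.1 • (Pi.single a 1 - dotProduct (Pi.single a 1) (u b.1) • u b.1)) +
            dotProduct (η (b.1 + unitVec b.2) • (Pi.single a 1 - dotProduct (Pi.single a 1) (u (b.1 + unitVec b.2)) • u (b.1 + unitVec b.2)))
              (η (b.1 + unitVec b.2) • (Pi.single a 1 - dotProduct (Pi.single a 1) (u (b.1 + unitVec b.2)) • u (b.1 + unitVec b.2))) -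
            2 * dotProduct (η b.1 • (Pi.single a 1 - dotProduct (Pi.single a 1) (u b.1) • u b.1))
              (η (b.1 + unitVec b.2) • (Pi.single a 1 - dotProduct (Pi.single a 1) (u (b.1 + unitVec b.2)) • u (b.1 + unitVec b.2))))) ≤
        ∑ b ∈ T, (9 * (η b.1 - η (b.1 + unitVec b.2)) ^ 2 +
          5 * (η b.1 * η (b.1 + unitVec b.2)) * dotProduct (u b.1 - u (b.1 + unitVec b.2)) (u b.1 - u (b.1 + unitVec b.2))) := by
      rw [Finset.sum_comm]
      exact Finset.sum_le_sum fun b _ => hR b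
    have ht2 : (3 : ℝ) * (1 / 20) ^ 2 = 3 / 400 := by norm_num
    have hs2 : ((4 : ℕ) : ℝ) * (2 * σ / (1 / 20) ^ 2) = 3200 * σ := by norm_num; ring
    rw [ht2, hs2] at h4
    have h5 : 3 / 400 * ∑ a : Fin 4, ∑ b ∈ T,
        ((1 - dotProduct (u b.1) (u (b.1 + unitVec b.2))) *
            (dotProduct (η b.1 • (Pi.single a 1 - dotProduct (Pi.single a 1) (u b.1) • u b.1))
                (η b.1 • (Pi.single a 1 - dotProduct (Pi.single a 1) (u b.1) • u b.1)) +
              dotProduct (η (b.1 + unitVec b.2) • (Pi.single a 1 - dotProduct (Pi.single a 1) (u (b.1 + unitVec b.2)) • u (b.1 + unitVec b.2)))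
                (η (b.1 + unitVec b.2) • (Pi.single a 1 - dotProduct (Pi.single a 1) (u (b.1 + unitVec b.2)) • u (b.1 + unitVec b.2)))) +
          (dotProduct (η b.1 • (Pi.single a 1 - dotProduct (Pi.single a 1) (u b.1) • u b.1))
              (η b.1 • (Pi.single a 1 - dotProduct (Pi.single a 1) (u b.1) • u b.1)) +
            dotProduct (η (b.1 + unitVec b.2) • (Pi.single a 1 - dotProduct (Pi.single a 1) (u (b.1 + unitVec b.2)) • u (b.1 + unitVec b.2)))
              (η (b.1 + unitVec b.2) • (Pi.single a 1 - dotProduct (Pi.single a 1) (u (b.1 + unitVec b.2)) • u (b.1 + unitVec b.2))) -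
            2 * dotProduct (η b.1 • (Pi.single a 1 - dotProduct (Pi.single a 1) (u b.1) • u b.1))
              (η (b.1 + unitVec b.2) • (Pi.single a 1 - dotProduct (Pi.single a 1) (u (b.1 + unitVec b.2)) • u (b.1 + unitVec b.2))))) ≤
        3 / 400 * ∑ b ∈ T, (9 * (η b.1 - η (b.1 + unitVec b.2)) ^ 2 +
          5 * (η b.1 * η (b.1 + unitVec b.2)) * dotProduct (u b.1 - u (b.1 + unitVec b.2)) (u b.1 - u (b.1 + unitVec b.2))) :=
      mul_le_mul_of_nonneg_left hR' (by norm_num)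
    linarith
  -- `(77/80)·X₀ ≤ (1227/400)·G₀ + 3200σ` with `X₀ = Σ ηηe`, `G₀ = Σ (dη)²`
  have hmain2 : 77 / 80 * ∑ b ∈ T, η b.1 * η (b.1 + unitVec b.2) * dotProduct (u b.1 - u (b.1 + unitVec b.2)) (u b.1 - u (b.1 + unitVec b.2)) ≤
      1227 / 400 * ∑ b ∈ T, (η b.1 - η (b.1 + unitVec b.2)) ^ 2 + 3200 * σ := by
    have h1 : (∑ b ∈ T, η b.1 * η (b.1 + unitVec b.2) * dotProduct (u b.1 - u (b.1 + unitVec b.2)) (u b.1 - u (b.1 + unitVec b.2))) -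
        3 * ∑ b ∈ T, (η b.1 - η (b.1 + unitVec b.2)) ^ 2 ≤
        ∑ b ∈ T, (η b.1 * η (b.1 + unitVec b.2) * dotProduct (u b.1 - u (b.1 + unitVec b.2)) (u b.1 - u (b.1 + unitVec b.2)) *
          (1 + dotProduct (u b.1 - u (b.1 + unitVec b.2)) (u b.1 - u (b.1 + unitVec b.2)) / 2) -
        3 * dotProduct (u b.1) (u (b.1 + unitVec b.2)) * (η b.1 - η (b.1 + unitVec b.2)) ^ 2) := by
      rw [Finset.mul_sum, ← Finset.sum_sub_distrib]
      refine Finset.sum_le_sum fun b _ => ?_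
      have hc1 : dotProduct (u b.1) (u (b.1 + unitVec b.2)) ≤ 1 := dot_le_one (hu _) (hu _)
      have hηη : 0 ≤ η b.1 * η (b.1 + unitVec b.2) := mul_nonneg (hη0 _) (hη0 _)
      have hee := he0 b
      nlinarith [mul_nonneg (mul_nonneg hηη hee) hee, sq_nonneg (η b.1 - η (b.1 + unitVec b.2)),
        mul_nonneg (sub_nonneg.2 hc1) (sq_nonneg (η b.1 - η (b.1 + unitVec b.2)))]
    have h2 : ∑ b ∈ T, (9 * (η b.1 - η (b.1 + unitVec b.2)) ^ 2 +
        5 * (η b.1 * η (b.1 + unitVec b.2)) * dotProduct (u b.1 - u (b.1 + unitVec b.2)) (u b.1 - u (b.1 + unitVec b.2))) =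
        9 * ∑ b ∈ T, (η b.1 - η (b.1 + unitVec b.2)) ^ 2 +
          5 * ∑ b ∈ T, η b.1 * η (b.1 + unitVec b.2) * dotProduct (u b.1 - u (b.1 + unitVec b.2)) (u b.1 - u (b.1 + unitVec b.2)) := by
      rw [Finset.sum_add_distrib, Finset.mul_sum, Finset.mul_sum]
      refine congrArg₂ (· + ·) rfl (Finset.sum_congr rfl fun b _ => by ring)
    rw [h2] at hmainb
    linarith
  -- (i) LEFT: Abel
  have hX_le := sum_box_energy_le_sum_profile T z hN hf0 hanti hsq
    (fun b => dotProduct (u b.1 - u (b.1 + unitVec b.2)) (u b.1 - u (b.1 + unitVec b.2))) he0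
  -- (ii) RIGHT: only bonds issuing from `Q_{2M}(z)` count, then the capacity
  have hgrad : ∑ b ∈ T, (η b.1 - η (b.1 + unitVec b.2)) ^ 2 ≤
      6 * (r : ℝ) * (∑ k ∈ Finset.Ico r M, 1 / ((k : ℝ) + 1) + 2) + 96 * r := by
    have h2 : ∑ b ∈ T, (η b.1 - η (b.1 + unitVec b.2)) ^ 2 ≤
        ∑ b ∈ (box z (2 * (M : ℤ))) ×ˢ (Finset.univ : Finset (Fin 3)), (η b.1 - η (b.1 + unitVec b.2)) ^ 2 := by
      rw [← Finset.sum_filter_add_sum_filter_not T (fun b => b.1 ∈ box z (2 * (M : ℤ)))]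
      have hz : ∑ b ∈ T.filter (fun b => ¬ b.1 ∈ box z (2 * (M : ℤ))), (η b.1 - η (b.1 + unitVec b.2)) ^ 2 = 0 := by
        refine Finset.sum_eq_zero fun b hb => ?_
        rw [Finset.mem_filter] at hb
        have hs := hNout b.1 hb.2
        have ht := (supIndex_step hN b.1 b.2).2
        simp only [hη]
        rw [hzero _ (by omega), hzero _ (by omega), sub_self, zero_pow two_ne_zero]
      rw [hz, add_zero]
      refine Finset.sum_le_sum_of_subset_of_nonneg ?_ fun b _ _ => by positivity
      intro b hb
      rw [Finset.mem_filter] at hb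
      exact Finset.mem_product.2 ⟨hb.2, Finset.mem_univ _⟩
    exact h2.trans (sum_sq_sub_profile_le z hN hr hrM.le hzero hone hlogInc htapInc)
  -- (iii) the contradiction
  by_contra hcon
  push Not at hcon
  have hne : (Finset.Ico r M).Nonempty := Finset.nonempty_Ico.2 hrM
  have hX : c * r * ∑ k ∈ Finset.Ico r M, 1 / ((k : ℝ) + 1) <
      ∑ k ∈ Finset.Ico r M, ((r : ℝ) / k - (r : ℝ) / (k + 1)) *
        ∑ b ∈ T.filter (fun b => b.1 ∈ box z (k : ℤ) ∧ b.1 + unitVec b.2 ∈ box z (k : ℤ)),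
          dotProduct (u b.1 - u (b.1 + unitVec b.2)) (u b.1 - u (b.1 + unitVec b.2)) := by
    rw [Finset.mul_sum]
    refine Finset.sum_lt_sum_of_nonempty hne fun k hk => ?_
    rw [Finset.mem_Ico] at hk
    have hk0 : (0 : ℝ) < k := by exact_mod_cast (lt_of_lt_of_le hr hk.1)
    have hlt := hcon k hk.1 hk.2
    have hw : (r : ℝ) / k - (r : ℝ) / (k + 1) = r / ((k : ℝ) * (k + 1)) := by field_simp; ring
    have hw0 : 0 < (r : ℝ) / k - (r : ℝ) / (k + 1) := by rw [hw]; positivity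
    calc c * r * (1 / ((k : ℝ) + 1)) = ((r : ℝ) / k - (r : ℝ) / (k + 1)) * (c * k) := by rw [hw]; field_simp
      _ < _ := mul_lt_mul_of_pos_left hlt hw0
  have hH := le_harmonic_of_window hH₀0 hr hM
  have hmain3 : 77 / 80 * ∑ k ∈ Finset.Ico r M, ((r : ℝ) / k - (r : ℝ) / (k + 1)) *
      ∑ b ∈ T.filter (fun b => b.1 ∈ box z (k : ℤ) ∧ b.1 + unitVec b.2 ∈ box z (k : ℤ)),
        dotProduct (u b.1 - u (b.1 + unitVec b.2)) (u b.1 - u (b.1 + unitVec b.2)) ≤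
      1227 / 400 * ∑ b ∈ T, (η b.1 - η (b.1 + unitVec b.2)) ^ 2 + 3200 * σ := by
    have := mul_le_mul_of_nonneg_left hX_le (by norm_num : (0:ℝ) ≤ 77 / 80)
    exact this.trans hmain2
  have hW : 3200 * σ ≤ (r : ℝ) := hσ
  have hG' : ∑ b ∈ T, (η b.1 - η (b.1 + unitVec b.2)) ^ 2 ≤
      6 * (r : ℝ) * (∑ k ∈ Finset.Ico r M, 1 / ((k : ℝ) + 1)) + 108 * r := by linarith
  have hlt := cap_arith_flat hc hr0 hX hmain3 hG' hW
  exact absurd hH (not_le.2 hlt)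

end Summit.QuantumFields.YangMills.Theorems.PoincareLipschitzLogCutoffStabilityCapFlat
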